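import Literature.Geometry.Lorentzian.BogovskiiKernelBaseDeriv
import Literature.Geometry.Lorentzian.BogovskiiVectorPointwise
import HarnessLib

/-!
# The frozen Calderón–Zygmund kernel of the first derivatives of the vector operator `SV_η`

(trunk G08 = T-LORENTZ; family `gr`; namespace `Literature.Geometry.Lorentzian.MaoOhTao`.)

Mao–Oh–Tao (arXiv:2308.13031), Lemma 2.3 (T3): `T_η : H^s → H^{s+1}`.  The vector operator
`(SV_η g)_a(x) = ∫ Φ_a(x − y; y) g(y) dy` has the classical kernel `Φ_a(z; y) = z_a Q₂[η](z; y)` (degree `−2`,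
`bogovskiiV_eq_classical`); its `z`-derivative is the degree `−3` kernel

  `KV[η](z; y) = ∂_{z_k}(z_a Q₂[η]) = δ_ak Q₂[η](z; y) + z_a Q₃[∂_kη](z; y)`   (`bogovskiiKV`, `pd_vectorKernel_eq`).

Recorded, in parallel with `BogovskiiKernelCZ` / `BogovskiiKernelBaseDeriv` for `S_η`: the representation
`(SV_η g)_a(x) = ∫ (x − y)_a Q₂[η](x − y; y) g(y) dy`, sizes `|Φ_a| ≤ 2MD³/|z|²`, `|KV| ≤ M(2D³ + 2D⁴)/|z|³`,
the gradient `∂_n KV` and `|∂_n KV| ≤ M(4D⁴ + 2D⁵)/|z|⁴`, the Lipschitz bound in the base point, vanishing for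
`|z| > (R + |y|)₊`, differentiability / `C¹` off the origin, joint measurability, the base-point rules
`∂_{y_b}KV[η] = KV[∂_bη]`, and the primitive `Φ_a` (`D_zΦ_a e_k = KV`).  These are the inputs of
`Literature.Analysis.SingularIntegrals.eLpNorm_truncate_convolution_le` for the gain-one estimate of `SV_η`.

## References

* Y. Mao, S.-J. Oh, T. Tao, arXiv:2308.13031 (2023), Lemma 2.3, pp. 8–9 (key `MaoOhTao2023`).
-/

noncomputable section

open scoped RealInnerProductSpace Topology
open Filter MeasureTheory Set Metric Function

namespace Literature.Geometry.Lorentzian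

namespace MaoOhTao

variable {η : E3 → ℝ} {R : ℝ}

/-- The **frozen CZ kernel of `∂_k SV_η`**: `KV[η](z; y) = δ_ak Q₂[η](z; y) + z_a Q₃[∂_kη](z; y)`.
[cite: MaoOhTao2023, Lemma 2.3] -/
def bogovskiiKV (η : E3 → ℝ) (y : E3) (a k : Fin 3) (z : E3) : ℝ :=
  (if a = k then 1 else 0) * bogovskiiQ η y 2 z + z a * bogovskiiQ (pd k η) y 3 z

/-- **The vector operator in classical form**: `(SV_η g)_a(x) = ∫ (x − y)_a Q₂[η](x − y; y) g(y) dy`.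
[cite: MaoOhTao2023, Lemma 2.3] -/
theorem bogovskiiSV_eq_integral_vectorKernel (η g : E3 → ℝ) (a : Fin 3) (x : E3) :
    bogovskiiSV η g a x = ∫ y : E3, (x - y) a * bogovskiiQ η y 2 (x - y) * g y := by
  rw [bogovskiiSV_apply]
  refine integral_congr_ae (ae_of_all _ fun y ↦ ?_)
  show bogovskiiWeight η y ‖x - y‖ (‖x - y‖⁻¹ • (x - y)) * ((x - y) a * (‖x - y‖ ^ 3)⁻¹) * g y =
    (x - y) a * bogovskiiQ η y 2 (x - y) * g y
  rw [bogovskiiV_eq_classical η y (x - y) a, bogovskiiQ_apply]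

/-- `∂_k(z_a Q₂[η]) = KV` off the origin (`η ∈ C¹`). [cite: MaoOhTao2023, Lemma 2.3] -/
theorem pd_vectorKernel_eq (hη : ContDiff ℝ 1 η) (hR : ∀ z : E3, R < ‖z‖ → η z = 0) (y : E3) (a k : Fin 3)
    {z : E3} (hz : z ≠ 0) : pd k (fun z : E3 ↦ z a * bogovskiiQ η y 2 z) z = bogovskiiKV η y a k z := by
  have hQ : DifferentiableAt ℝ (bogovskiiQ η y 2) z := differentiableAt_bogovskiiQ hη hR y 2 hz
  have hza : DifferentiableAt ℝ (fun z : E3 ↦ z a) z := (EuclideanSpace.proj (𝕜 := ℝ) a).differentiableAt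
  rw [pd_mul hza hQ, pd_coord, pd_bogovskiiQ hη hR y 2 k hz, bogovskiiKV]

/-- The classical vector kernel is differentiable off the origin (`η ∈ C¹`), with `D(z_aQ₂[η]) e_k = KV`. [folklore] -/
theorem differentiableAt_vectorKernel (hη : ContDiff ℝ 1 η) (hR : ∀ z : E3, R < ‖z‖ → η z = 0) (y : E3) (a : Fin 3)
    {z : E3} (hz : z ≠ 0) :
    DifferentiableAt ℝ (fun z : E3 ↦ z a * bogovskiiQ η y 2 z) z ∧
      ∀ k, fderiv ℝ (fun z : E3 ↦ z a * bogovskiiQ η y 2 z) z (e k) = bogovskiiKV η y a k z := by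
  have hQ : DifferentiableAt ℝ (bogovskiiQ η y 2) z := differentiableAt_bogovskiiQ hη hR y 2 hz
  have hza : DifferentiableAt ℝ (fun z : E3 ↦ z a) z := (EuclideanSpace.proj (𝕜 := ℝ) a).differentiableAt
  exact ⟨hza.mul hQ, fun k ↦ pd_vectorKernel_eq hη hR y a k hz⟩

/-- **Size of the vector kernel** `|z_a Q₂[η](z; y)| ≤ 2MD³/|z|²` (`|η| ≤ M`, `|y| ≤ ρ`, `D = (R + ρ)₊`, all `z`).
[cite: MaoOhTao2023, Lemma 2.3] -/
theorem abs_vectorKernel_le (hη : Continuous η) (hR : ∀ z : E3, R < ‖z‖ → η z = 0) {M : ℝ} (hM0 : ∀ w, |η w| ≤ M)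
    {ρ : ℝ} {y : E3} (hy : ‖y‖ ≤ ρ) (a : Fin 3) (z : E3) :
    |z a * bogovskiiQ η y 2 z| ≤ 2 * M * (max (R + ρ) 0) ^ 3 / ‖z‖ ^ 2 := by
  by_cases hz : z = 0
  · subst hz; simp
  have hn : 0 < ‖z‖ := norm_pos_iff.2 hz
  have hza : |z a| ≤ ‖z‖ := by simpa using PiLp.norm_apply_le z a
  rw [abs_mul]
  calc |z a| * |bogovskiiQ η y 2 z| ≤ ‖z‖ * (2 * M * (max (R + ρ) 0) ^ 3 / ‖z‖ ^ 3) :=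
        mul_le_mul hza (abs_bogovskiiQ_le_of_norm_le hη hR hM0 hy 2 hz) (abs_nonneg _) (norm_nonneg _)
    _ = _ := by field_simp

/-- **Size of `KV`**: `|KV(z; y)| ≤ M(2D³ + 2D⁴)/|z|³` (`η ∈ C¹`, `|η|, |∂η| ≤ M`, `|y| ≤ ρ`, `z ≠ 0`).
[cite: MaoOhTao2023, Lemma 2.3 (T3)] -/
theorem abs_bogovskiiKV_le (hη : ContDiff ℝ 1 η) (hR : ∀ z : E3, R < ‖z‖ → η z = 0) {M : ℝ} (hM0 : ∀ w, |η w| ≤ M)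
    (hM1 : ∀ a w, |pd a η w| ≤ M) {ρ : ℝ} {y : E3} (hy : ‖y‖ ≤ ρ) (a k : Fin 3) {z : E3} (hz : z ≠ 0) :
    |bogovskiiKV η y a k z| ≤ M * (2 * (max (R + ρ) 0) ^ 3 + 2 * (max (R + ρ) 0) ^ 4) / ‖z‖ ^ 3 := by
  have hn : 0 < ‖z‖ := norm_pos_iff.2 hz
  have hMnn : 0 ≤ M := (abs_nonneg _).trans (hM0 0)
  set D : ℝ := max (R + ρ) 0 with hD
  have hD0 : 0 ≤ D := le_max_right _ _
  obtain ⟨hkη, hRk⟩ := contDiff_pd_and_vanish (n := 0) hη hR k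
  have bQ2 : |bogovskiiQ η y 2 z| ≤ 2 * M * D ^ 3 / ‖z‖ ^ 3 := abs_bogovskiiQ_le_of_norm_le hη.continuous hR hM0 hy 2 hz
  have bQ3 : |bogovskiiQ (pd k η) y 3 z| ≤ 2 * M * D ^ 4 / ‖z‖ ^ 4 :=
    abs_bogovskiiQ_le_of_norm_le hkη.continuous hRk (hM1 k) hy 3 hz
  have bδ : |(if a = k then (1 : ℝ) else 0)| ≤ 1 := by split_ifs <;> norm_num
  have hza : |z a| ≤ ‖z‖ := by simpa using PiLp.norm_apply_le z a
  rw [bogovskiiKV]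
  calc _ ≤ |(if a = k then (1 : ℝ) else 0) * bogovskiiQ η y 2 z| + |z a * bogovskiiQ (pd k η) y 3 z| := abs_add_le _ _
    _ ≤ 1 * (2 * M * D ^ 3 / ‖z‖ ^ 3) + ‖z‖ * (2 * M * D ^ 4 / ‖z‖ ^ 4) := by
        rw [abs_mul, abs_mul]
        exact add_le_add (mul_le_mul bδ bQ2 (abs_nonneg _) zero_le_one)
          (mul_le_mul hza bQ3 (abs_nonneg _) (norm_nonneg _))
    _ = M * (2 * D ^ 3 + 2 * D ^ 4) / ‖z‖ ^ 3 := by field_simp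

/-- `KV` vanishes for `|z| > (R + |y|)₊`. [folklore] -/
theorem bogovskiiKV_eq_zero_of_lt (hR : ∀ z : E3, R < ‖z‖ → η z = 0) (y : E3) (a k : Fin 3) {z : E3}
    (hz : max (R + ‖y‖) 0 < ‖z‖) : bogovskiiKV η y a k z = 0 := by
  have hRk : ∀ z : E3, R < ‖z‖ → pd k η z = 0 := fun z hz ↦ pd_eq_zero_of_norm_lt hR k z hz
  simp only [bogovskiiKV, bogovskiiQ_eq_zero_of_lt hR y 2 hz, bogovskiiQ_eq_zero_of_lt hRk y 3 hz, mul_zero, add_zero]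

/-- The classical vector kernel vanishes for `|z| > (R + |y|)₊`. [folklore] -/
theorem vectorKernel_eq_zero_of_lt (hR : ∀ z : E3, R < ‖z‖ → η z = 0) (y : E3) (a : Fin 3) {z : E3}
    (hz : max (R + ‖y‖) 0 < ‖z‖) : z a * bogovskiiQ η y 2 z = 0 := by
  rw [bogovskiiQ_eq_zero_of_lt hR y 2 hz, mul_zero]

/-- `KV` is differentiable off the origin (`η ∈ C²`). [folklore] -/
theorem differentiableAt_bogovskiiKV (hη : ContDiff ℝ 2 η) (hR : ∀ z : E3, R < ‖z‖ → η z = 0) (y : E3) (a k : Fin 3)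
    {z : E3} (hz : z ≠ 0) : DifferentiableAt ℝ (bogovskiiKV η y a k) z := by
  have h1 : ContDiff ℝ 1 η := hη.of_le (by norm_cast)
  obtain ⟨hkη, hRk⟩ := contDiff_pd_and_vanish (n := 1) hη hR k
  have hQ2 := differentiableAt_bogovskiiQ h1 hR y 2 hz
  have hQ3 := differentiableAt_bogovskiiQ hkη hRk y 3 hz
  have hza : DifferentiableAt ℝ (fun z : E3 ↦ z a) z := (EuclideanSpace.proj (𝕜 := ℝ) a).differentiableAt
  unfold bogovskiiKV
  fun_prop

/-- `KV(·; y)` is continuous off the origin (`η ∈ C²`). [folklore] -/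
theorem continuousOn_bogovskiiKV (hη : ContDiff ℝ 2 η) (hR : ∀ z : E3, R < ‖z‖ → η z = 0) (y : E3) (a k : Fin 3) :
    ContinuousOn (bogovskiiKV η y a k) {0}ᶜ := fun _ hz ↦
  (differentiableAt_bogovskiiKV hη hR y a k hz).continuousAt.continuousWithinAt

/-- `KV(·; y) ∈ C¹(ℝ³ ∖ 0)` (`η ∈ C³`). [folklore] -/
theorem contDiffOn_bogovskiiKV (hη : ContDiff ℝ 3 η) (hR : ∀ z : E3, R < ‖z‖ → η z = 0) (y : E3) (a k : Fin 3) :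
    ContDiffOn ℝ 1 (bogovskiiKV η y a k) {0}ᶜ := by
  have h2 : ContDiff ℝ 2 η := hη.of_le (by norm_cast)
  obtain ⟨hkη, hRk⟩ := contDiff_pd_and_vanish (n := 2) hη hR k
  have hQ2 := contDiffOn_bogovskiiQ h2 hR y 2
  have hQ3 := contDiffOn_bogovskiiQ hkη hRk y 3
  have hza : ContDiff ℝ 1 (fun z : E3 ↦ z a) := (EuclideanSpace.proj (𝕜 := ℝ) a).contDiff
  unfold bogovskiiKV
  exact (contDiffOn_const.mul hQ2).add (hza.contDiffOn.mul hQ3)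

/-- **Gradient of `KV`** off the origin (`η ∈ C²`):
`∂_n KV = δ_ak Q₃[∂_nη] + δ_an Q₃[∂_kη] + z_a Q₄[∂_n∂_kη]`. [cite: MaoOhTao2023, Lemma 2.3] -/
theorem pd_bogovskiiKV_eq (hη : ContDiff ℝ 2 η) (hR : ∀ z : E3, R < ‖z‖ → η z = 0) (y : E3) (a k n : Fin 3) {z : E3}
    (hz : z ≠ 0) :
    pd n (bogovskiiKV η y a k) z =
      (if a = k then 1 else 0) * bogovskiiQ (pd n η) y 3 z +
        ((if a = n then 1 else 0) * bogovskiiQ (pd k η) y 3 z + z a * bogovskiiQ (pd n (pd k η)) y 4 z) := by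
  have h1 : ContDiff ℝ 1 η := hη.of_le (by norm_cast)
  obtain ⟨hkη, hRk⟩ := contDiff_pd_and_vanish (n := 1) hη hR k
  have hQ2 := differentiableAt_bogovskiiQ h1 hR y 2 hz
  have hQ3 := differentiableAt_bogovskiiQ hkη hRk y 3 hz
  have hza : DifferentiableAt ℝ (fun z : E3 ↦ z a) z := (EuclideanSpace.proj (𝕜 := ℝ) a).differentiableAt
  have dT1 : DifferentiableAt ℝ (fun z : E3 ↦ (if a = k then (1 : ℝ) else 0) * bogovskiiQ η y 2 z) z := hQ2.const_mul _
  have dT2 : DifferentiableAt ℝ (fun z : E3 ↦ z a * bogovskiiQ (pd k η) y 3 z) z := hza.mul hQ3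
  have hK : bogovskiiKV η y a k = fun z ↦ (if a = k then (1 : ℝ) else 0) * bogovskiiQ η y 2 z +
      z a * bogovskiiQ (pd k η) y 3 z := rfl
  rw [hK, pd_add dT1 dT2, pd_const_mul' _ hQ2, pd_mul hza hQ3, pd_coord, pd_bogovskiiQ h1 hR y 2 n hz,
    pd_bogovskiiQ hkη hRk y 3 n hz]

/-- **Size of the gradient of `KV`**: `|∂_n KV| ≤ M(4D⁴ + 2D⁵)/|z|⁴` (`η ∈ C²`, `|∂η|, |∂²η| ≤ M`, `|y| ≤ ρ`, `z ≠ 0`).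
[cite: MaoOhTao2023, Lemma 2.3 (T3)] -/
theorem abs_pd_bogovskiiKV_le (hη : ContDiff ℝ 2 η) (hR : ∀ z : E3, R < ‖z‖ → η z = 0) {M : ℝ}
    (hM1 : ∀ a w, |pd a η w| ≤ M) (hM2 : ∀ a b w, |pd a (pd b η) w| ≤ M) {ρ : ℝ} {y : E3} (hy : ‖y‖ ≤ ρ)
    (a k n : Fin 3) {z : E3} (hz : z ≠ 0) :
    |pd n (bogovskiiKV η y a k) z| ≤ M * (4 * (max (R + ρ) 0) ^ 4 + 2 * (max (R + ρ) 0) ^ 5) / ‖z‖ ^ 4 := by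
  have hn : 0 < ‖z‖ := norm_pos_iff.2 hz
  have hMnn : 0 ≤ M := (abs_nonneg _).trans (hM1 0 0)
  set D : ℝ := max (R + ρ) 0 with hD
  have hD0 : 0 ≤ D := le_max_right _ _
  obtain ⟨hkη, hRk⟩ := contDiff_pd_and_vanish (n := 1) hη hR k
  obtain ⟨hnη, hRn⟩ := contDiff_pd_and_vanish (n := 1) hη hR n
  obtain ⟨hnkη, hRnk⟩ := contDiff_pd_and_vanish (n := 0) hkη hRk n
  have b3n : |bogovskiiQ (pd n η) y 3 z| ≤ 2 * M * D ^ 4 / ‖z‖ ^ 4 :=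
    abs_bogovskiiQ_le_of_norm_le hnη.continuous hRn (hM1 n) hy 3 hz
  have b3k : |bogovskiiQ (pd k η) y 3 z| ≤ 2 * M * D ^ 4 / ‖z‖ ^ 4 :=
    abs_bogovskiiQ_le_of_norm_le hkη.continuous hRk (hM1 k) hy 3 hz
  have b4 : |bogovskiiQ (pd n (pd k η)) y 4 z| ≤ 2 * M * D ^ 5 / ‖z‖ ^ 5 :=
    abs_bogovskiiQ_le_of_norm_le hnkη.continuous hRnk (hM2 n k) hy 4 hz
  have bδ1 : |(if a = k then (1 : ℝ) else 0)| ≤ 1 := by split_ifs <;> norm_num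
  have bδ2 : |(if a = n then (1 : ℝ) else 0)| ≤ 1 := by split_ifs <;> norm_num
  have hza : |z a| ≤ ‖z‖ := by simpa using PiLp.norm_apply_le z a
  rw [pd_bogovskiiKV_eq hη hR y a k n hz]
  calc _ ≤ |(if a = k then (1 : ℝ) else 0) * bogovskiiQ (pd n η) y 3 z| +
        (|(if a = n then (1 : ℝ) else 0) * bogovskiiQ (pd k η) y 3 z| + |z a * bogovskiiQ (pd n (pd k η)) y 4 z|) :=
          (abs_add_le _ _).trans (add_le_add le_rfl (abs_add_le _ _))
    _ ≤ 1 * (2 * M * D ^ 4 / ‖z‖ ^ 4) + (1 * (2 * M * D ^ 4 / ‖z‖ ^ 4) + ‖z‖ * (2 * M * D ^ 5 / ‖z‖ ^ 5)) := by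
          rw [abs_mul, abs_mul, abs_mul]
          exact add_le_add (mul_le_mul bδ1 b3n (abs_nonneg _) zero_le_one)
            (add_le_add (mul_le_mul bδ2 b3k (abs_nonneg _) zero_le_one)
              (mul_le_mul hza b4 (abs_nonneg _) (norm_nonneg _)))
    _ = M * (4 * D ^ 4 + 2 * D ^ 5) / ‖z‖ ^ 4 := by field_simp; ring

/-- `‖D KV(z)‖ ≤ 3M(4D⁴ + 2D⁵)/|z|⁴`. [cite: MaoOhTao2023, Lemma 2.3 (T3)] -/
theorem norm_fderiv_bogovskiiKV_le (hη : ContDiff ℝ 2 η) (hR : ∀ z : E3, R < ‖z‖ → η z = 0) {M : ℝ}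
    (hM1 : ∀ a w, |pd a η w| ≤ M) (hM2 : ∀ a b w, |pd a (pd b η) w| ≤ M) {ρ : ℝ} {y : E3} (hy : ‖y‖ ≤ ρ)
    (a k : Fin 3) {z : E3} (hz : z ≠ 0) :
    ‖fderiv ℝ (bogovskiiKV η y a k) z‖ ≤ 3 * (M * (4 * (max (R + ρ) 0) ^ 4 + 2 * (max (R + ρ) 0) ^ 5) / ‖z‖ ^ 4) := by
  refine (norm_fderiv_le_sum_abs_pd _ z).trans ?_
  calc ∑ m, |pd m (bogovskiiKV η y a k) z|
      ≤ ∑ _m : Fin 3, M * (4 * (max (R + ρ) 0) ^ 4 + 2 * (max (R + ρ) 0) ^ 5) / ‖z‖ ^ 4 :=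
        Finset.sum_le_sum fun m _ ↦ abs_pd_bogovskiiKV_le hη hR hM1 hM2 hy a k m hz
    _ = _ := by simp [Finset.sum_const, Finset.card_univ, Fintype.card_fin]

/-- **Lipschitz bound of `KV` in the base point**: for `η ∈ C²` with `|∂η|, |∂²η| ≤ M`, `|y₁|, |y₂| ≤ ρ`, `z ≠ 0`:
`|KV(z; y₁) − KV(z; y₂)| ≤ 3M|y₁ − y₂|(2D³ + 2D⁴)/|z|³`. [cite: MaoOhTao2023, Lemma 2.3 (T3)] -/
theorem abs_bogovskiiKV_sub_le (hη : ContDiff ℝ 2 η) (hR : ∀ z : E3, R < ‖z‖ → η z = 0) {M : ℝ}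
    (hM1 : ∀ a w, |pd a η w| ≤ M) (hM2 : ∀ a b w, |pd a (pd b η) w| ≤ M) {ρ : ℝ} {y₁ y₂ : E3} (hy₁ : ‖y₁‖ ≤ ρ)
    (hy₂ : ‖y₂‖ ≤ ρ) (a k : Fin 3) {z : E3} (hz : z ≠ 0) :
    |bogovskiiKV η y₁ a k z - bogovskiiKV η y₂ a k z| ≤
      3 * M * ‖y₁ - y₂‖ * (2 * (max (R + ρ) 0) ^ 3 + 2 * (max (R + ρ) 0) ^ 4) / ‖z‖ ^ 3 := by
  have hn : 0 < ‖z‖ := norm_pos_iff.2 hz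
  have hMnn : 0 ≤ M := (abs_nonneg _).trans (hM1 0 0)
  set D : ℝ := max (R + ρ) 0 with hD
  have hD0 : 0 ≤ D := le_max_right _ _
  have h1 : ContDiff ℝ 1 η := hη.of_le (by norm_cast)
  obtain ⟨hkη, hRk⟩ := contDiff_pd_and_vanish (n := 1) hη hR k
  have nη : ∀ w, ‖fderiv ℝ η w‖ ≤ 3 * M := fun w ↦ (norm_fderiv_le_sum_abs_pd η w).trans (by
    calc ∑ m, |pd m η w| ≤ ∑ _m : Fin 3, M := Finset.sum_le_sum fun m _ ↦ hM1 m w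
      _ = 3 * M := by simp)
  have nk : ∀ w, ‖fderiv ℝ (pd k η) w‖ ≤ 3 * M := fun w ↦ (norm_fderiv_le_sum_abs_pd _ w).trans (by
    calc ∑ m, |pd m (pd k η) w| ≤ ∑ _m : Fin 3, M := Finset.sum_le_sum fun m _ ↦ hM2 m k w
      _ = 3 * M := by simp)
  set δ : ℝ := ‖y₁ - y₂‖ with hδ
  have b2 : |bogovskiiQ η y₁ 2 z - bogovskiiQ η y₂ 2 z| ≤ 2 * (3 * M * δ) * D ^ 3 / ‖z‖ ^ 3 :=
    abs_bogovskiiQ_sub_le_of_norm_le h1 hR nη hy₁ hy₂ 2 hz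
  have b3 : |bogovskiiQ (pd k η) y₁ 3 z - bogovskiiQ (pd k η) y₂ 3 z| ≤ 2 * (3 * M * δ) * D ^ 4 / ‖z‖ ^ 4 :=
    abs_bogovskiiQ_sub_le_of_norm_le hkη hRk nk hy₁ hy₂ 3 hz
  have bδ : |(if a = k then (1 : ℝ) else 0)| ≤ 1 := by split_ifs <;> norm_num
  have hza : |z a| ≤ ‖z‖ := by simpa using PiLp.norm_apply_le z a
  have hdiff : bogovskiiKV η y₁ a k z - bogovskiiKV η y₂ a k z =
      (if a = k then 1 else 0) * (bogovskiiQ η y₁ 2 z - bogovskiiQ η y₂ 2 z) +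
        z a * (bogovskiiQ (pd k η) y₁ 3 z - bogovskiiQ (pd k η) y₂ 3 z) := by
    simp only [bogovskiiKV]; ring
  rw [hdiff]
  calc _ ≤ |(if a = k then (1 : ℝ) else 0) * (bogovskiiQ η y₁ 2 z - bogovskiiQ η y₂ 2 z)| +
        |z a * (bogovskiiQ (pd k η) y₁ 3 z - bogovskiiQ (pd k η) y₂ 3 z)| := abs_add_le _ _
    _ ≤ 1 * (2 * (3 * M * δ) * D ^ 3 / ‖z‖ ^ 3) + ‖z‖ * (2 * (3 * M * δ) * D ^ 4 / ‖z‖ ^ 4) := by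
        rw [abs_mul, abs_mul]
        exact add_le_add (mul_le_mul bδ b2 (abs_nonneg _) zero_le_one)
          (mul_le_mul hza b3 (abs_nonneg _) (norm_nonneg _))
    _ = 3 * M * δ * (2 * D ^ 3 + 2 * D ^ 4) / ‖z‖ ^ 3 := by field_simp

/-- Joint measurability of `(z, y) ↦ KV(z; y)` (`η ∈ C¹`). [folklore] -/
theorem measurable_bogovskiiKV_uncurry (hη : ContDiff ℝ 1 η) (a k : Fin 3) :
    Measurable fun p : E3 × E3 ↦ bogovskiiKV η p.2 a k p.1 := by
  have hk : Continuous (pd k η) := (contDiff_pd (n := 0) hη k).continuous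
  have ma : Measurable fun p : E3 × E3 ↦ p.1 a := (EuclideanSpace.proj (𝕜 := ℝ) a).continuous.measurable.comp
    measurable_fst
  unfold bogovskiiKV
  exact (measurable_const.mul (measurable_bogovskiiQ_uncurry hη.continuous 2)).add
    (ma.mul (measurable_bogovskiiQ_uncurry hk 3))

/-- Joint measurability of the classical vector kernel `(z, y) ↦ z_a Q₂[η](z; y)`. [folklore] -/
theorem measurable_vectorKernel_uncurry (hη : Continuous η) (a : Fin 3) :
    Measurable fun p : E3 × E3 ↦ p.1 a * bogovskiiQ η p.2 2 p.1 := by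
  have ma : Measurable fun p : E3 × E3 ↦ p.1 a := (EuclideanSpace.proj (𝕜 := ℝ) a).continuous.measurable.comp
    measurable_fst
  exact ma.mul (measurable_bogovskiiQ_uncurry hη 2)

/-- **Base-point rule** `∂_{y_b}KV[η](z; y) = KV[∂_bη](z; y)` (`η ∈ C²`, `z ≠ 0`). [cite: MaoOhTao2023, Lemma 2.3] -/
theorem hasFDerivAt_bogovskiiKV_base (hη : ContDiff ℝ 2 η) (hR : ∀ z : E3, R < ‖z‖ → η z = 0) (a k : Fin 3)
    {z : E3} (hz : z ≠ 0) (y : E3) :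
    DifferentiableAt ℝ (fun y ↦ bogovskiiKV η y a k z) y ∧
      ∀ b : Fin 3, fderiv ℝ (fun y ↦ bogovskiiKV η y a k z) y (e b) = bogovskiiKV (pd b η) y a k z := by
  have h1 : ContDiff ℝ 1 η := hη.of_le (by norm_cast)
  obtain ⟨hkη, hRk⟩ := contDiff_pd_and_vanish (n := 1) hη hR k
  have dQ2 := differentiableAt_bogovskiiQ_base h1 hR 2 hz y
  have dQ3 := differentiableAt_bogovskiiQ_base hkη hRk 3 hz y
  have dT1 : DifferentiableAt ℝ (fun y ↦ (if a = k then (1 : ℝ) else 0) * bogovskiiQ η y 2 z) y := dQ2.const_mul _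
  have dT2 : DifferentiableAt ℝ (fun y ↦ z a * bogovskiiQ (pd k η) y 3 z) y := dQ3.const_mul _
  have hK : (fun y ↦ bogovskiiKV η y a k z) = fun y ↦ (if a = k then (1 : ℝ) else 0) * bogovskiiQ η y 2 z +
      z a * bogovskiiQ (pd k η) y 3 z := rfl
  refine ⟨by rw [hK]; exact dT1.add dT2, fun b ↦ ?_⟩
  rw [hK, fderiv_fun_add dT1 dT2, fderiv_const_mul dQ2, fderiv_const_mul dQ3]
  simp only [_root_.add_apply, _root_.smul_apply, smul_eq_mul]
  rw [fderiv_bogovskiiQ_base_e h1 hR 2 hz y b, fderiv_bogovskiiQ_base_e hkη hRk 3 hz y b]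
  have c : pd b (pd k η) = pd k (pd b η) := funext fun x ↦ pd_pd_comm hη.contDiffAt b k
  rw [c]
  rfl

/-- **Norm of the base-point derivative of `KV`**: `‖D_y KV[η](z; y)‖ ≤ 3M(2D³ + 2D⁴)/|z|³` (`η ∈ C²`,
`|∂η|, |∂²η| ≤ M`, `|y| ≤ ρ`, `z ≠ 0`). [cite: MaoOhTao2023, Lemma 2.3 (T3)] -/
theorem norm_fderiv_bogovskiiKV_base_le (hη : ContDiff ℝ 2 η) (hR : ∀ z : E3, R < ‖z‖ → η z = 0) {M : ℝ}
    (hM1 : ∀ a w, |pd a η w| ≤ M) (hM2 : ∀ a b w, |pd a (pd b η) w| ≤ M) {ρ : ℝ} {y : E3} (hy : ‖y‖ ≤ ρ)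
    (a k : Fin 3) {z : E3} (hz : z ≠ 0) :
    ‖fderiv ℝ (fun y ↦ bogovskiiKV η y a k z) y‖ ≤ 3 * (M * (2 * (max (R + ρ) 0) ^ 3 + 2 * (max (R + ρ) 0) ^ 4) / ‖z‖ ^ 3) := by
  refine (norm_fderiv_le_sum_abs_pd _ y).trans ?_
  calc ∑ b, |pd b (fun y ↦ bogovskiiKV η y a k z) y|
      ≤ ∑ _b : Fin 3, M * (2 * (max (R + ρ) 0) ^ 3 + 2 * (max (R + ρ) 0) ^ 4) / ‖z‖ ^ 3 := by
        refine Finset.sum_le_sum fun b _ ↦ ?_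
        rw [pd, (hasFDerivAt_bogovskiiKV_base hη hR a k hz y).2 b]
        obtain ⟨hbη, hRb⟩ := contDiff_pd_and_vanish (n := 1) hη hR b
        exact abs_bogovskiiKV_le hbη hRb (hM1 b) (fun c w ↦ hM2 c b w) hy a k hz
    _ = _ := by simp [Finset.sum_const, Finset.card_univ, Fintype.card_fin]

end MaoOhTao

end Literature.Geometry.Lorentzian
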